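import Mathlib
import Summits.MatrixMultiplication.MatrixMultiplication.Statement
import Literature.Computability.AlgebraicComplexity.BCGPUInfiniteGroupsProofs
import Literature.Computability.AlgebraicComplexity.BCGPUSeparatingPolynomials

/-!
# The fixed-group Lie door at `GL₂(ℂ)`: TPP designs with degree-`s` separating polynomials

Blasiak–Cohn–Grochow–Pratt–Umans (arXiv:2410.14905, ITCS 2025) prove (Thm. 2.2; in the tree, TPP
in embedding form, as `BCGPU2024_thm_2_2_corrected_holds`) that finite `X, Y, Z ⊆ G` with the TPP
and separating functions inside `RepFun(R_sep)` give `(|X||Y||Z|)^{ω/3} ≤ ∑_{ρ ∈ R_sep} (dim ρ)^ω`,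
and price it in `GL_n(ℂ)` (Cor. 2.8; tree: the named fact `BCGPU2024_cor_2_8`, stated for `n ≥ 3`
because its Lemma 2.7 needs `n ≥ 3`). Their §4 (open problem 4, p. 34) asks for constructions
"in a single, fixed infinite group (say, `GL₃`), with growing families of sets `(X_q, Y_q, Z_q)`".

This file works out the SMALLEST fixed group, `GL₂(ℂ)`, as a door to the summit. The one
representation-theoretic input — the `n = 2` case of the [DRS74]/[dCEP80] basis theorem quoted
on p. 15 of the source ("the entries of `Irr_i`, `i ≤ s`, are a basis" of the entry polynomials
of degree `≤ s`; for `GL₂` the polynomial irreducibles are `Sym^k ⊗ det^m`, `k + 2m ≤ s`, of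
dimension `k + 1 ≤ s + 1`, and `∑_{k+2m ≤ s} (k+1)² = C(s+4,4) = dim ℂ[M₂]_{≤ s}`) — is NOT
vendored (Mathlib has no polynomial representation theory of `GL_n`; cf. the tree's
`BCGPUSeparatingPolynomials.lean`); it enters every theorem below as the EXPLICIT hypothesis
"`hPW`: a finite family `ρ_i : GL₂(ℂ) → GL_{n_i}(ℂ)` with `n_i ≤ s + 1`, `∑ n_i² ≤ C(s+4,4)`,
whose `repFun` contains every entry polynomial of degree `≤ s`", so the trust base is visible.

* `glTwo_volume_rpow_le` — **the `GL₂` cost inequality**: under `hPW`, a TPP triple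
  `X, Y, Z ⊆ GL₂(ℂ)` (embedding form) with separating polynomials of degree `≤ s` has
  `(|X||Y||Z|)^{ω/3} ≤ C(s+4,4) · (s+1)^{ω−2}` — Cor. 2.8 at `n = 2` with `d_max = s + 1` in
  place of Lemma 2.7 (the tree's Thm. 2.2 + `sum_rpow_omega_le_of_le`).
* `omega_le_of_glTwo_designs` — **exponent door**: if for some `a > 1` there are, for
  arbitrarily large `s`, such designs of volume `|X||Y||Z| ≥ s^{3a}`, then `ω(ℂ) ≤ 2/(a − 1)`.
* `matrixMultiplication_of_glTwo_designs` — **the door**: designs with `a → 2` give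
  `MatrixMultiplication` (`ω(ℂ) = 2`). `glTwo_threshold_three` / `glTwo_trivial_level` record
  that `ω < 3` by this door needs `a > 5/3` and that `a = 4/3` reads `ω ≤ 6`.

Where the door stands (informal; nothing below depends on it): the packing count
`|X||Z| ≤ C(s+4,4)` caps `a ≤ 2`; the level `3a = 4` is TRIVIAL (`Y = {1}` with `C(s+4,4)`
points `X Z⁻¹` in general position, or the Bruhat-cell design `X ⊂ U⁻`, `Y ⊂ T`, `Z ⊂ U⁺`,
whose TPP is uniqueness of the `LDU` factorisation) and certifies only `ω ≤ 6`;
complex-algebraic families are capped at `3a ≤ dim GL₂ = 4` (arXiv:2204.03826, Thm. 4.7) and so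
is the first-order (Lie-algebra, hence abelian) regime. Whether `3a > 4` is attainable in
`GL₂(ℂ)` — it needs designs that are neither complex-algebraic nor infinitesimal, whose quotient
sets `X Y⁻¹ Y Z⁻¹` have abnormally small degree-`s` Hilbert function — is open; the soloist's
working conjecture is `3a* = 4` (the `GL₂` door is shut at the trivial level).

References: [BlasiakCohnGrochowPrattUmans2024] arXiv:2410.14905 — Def. 2.1, Thm. 2.2, Lemma 2.7,
Cor. 2.8 (p. 15), §4 (pp. 33–34); [DRS74] P. Doubilet, G.-C. Rota, J. Stein, Stud. Appl. Math.
53 (1974) 185–216; [dCEP80] C. De Concini, D. Eisenbud, C. Procesi, Invent. Math. 56 (1980)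
129–165; J. Blasiak, H. Cohn, J. A. Grochow, K. Pratt, C. Umans, *Matrix multiplication via
matrix groups*, arXiv:2204.03826 (ITCS 2023), Thm. 4.7.
-/

noncomputable section

open scoped BigOperators

namespace Summit.MatrixMultiplication.MatrixMultiplication.Theorems

open Literature.Computability.AlgebraicComplexity

/-- `GL₂(ℂ)`. [folklore] -/
abbrev GLTwo : Type := Matrix.GeneralLinearGroup (Fin 2) ℂ

/-- Evaluation of a polynomial in the four matrix entries at `g ∈ GL₂(ℂ)` (holomorphic polynomial
functions on `GL₂(ℂ) ⊆ M₂(ℂ)`, exactly as in the tree's `BCGPU2024_cor_2_8`).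
[cite: BlasiakCohnGrochowPrattUmans2024, Cor. 2.8] -/
def entryEval (p : MvPolynomial (Fin 2 × Fin 2) ℂ) (g : GLTwo) : ℂ :=
  MvPolynomial.eval (fun ij : Fin 2 × Fin 2 => (g : Matrix (Fin 2) (Fin 2) ℂ) ij.1 ij.2) p

/-! ## The `GL₂` cost inequality -/

/-- **Cor. 2.8 at `n = 2`.** Given a finite family of matrix representations `ρ_i` of `GL₂(ℂ)`
of dimensions `n_i ≤ s + 1` with `∑ n_i² ≤ C(s+4,4)` whose `repFun` contains every entry
polynomial of degree `≤ s` (the truncated Peter–Weyl / [DRS74] input, as a hypothesis), a TPP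
triple in `GL₂(ℂ)` (embedding form) with degree-`≤ s` separating polynomials satisfies
`(|X||Y||Z|)^{ω/3} ≤ C(s+4,4) · (s+1)^{ω−2}` (Thm. 2.2, proved in the tree, then
`∑ n_i^ω ≤ (∑ n_i²) · d_max^{ω−2}` with `d_max = s + 1`).
[cite: BlasiakCohnGrochowPrattUmans2024, Thm. 2.2, Cor. 2.8] -/
theorem glTwo_volume_rpow_le {s r : ℕ} {n : Fin r → ℕ}
    (ρ : ∀ i, GLTwo →* Matrix.GeneralLinearGroup (Fin (n i)) ℂ)
    (hn : ∀ i, n i ≤ s + 1) (hsum : ∑ i, n i ^ 2 ≤ (s + 4).choose 4)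
    (hspan : ∀ p : MvPolynomial (Fin 2 × Fin 2) ℂ, p.totalDegree ≤ s → entryEval p ∈ repFun n ρ)
    {X Y Z : Finset GLTwo}
    (hTPP : ∀ x ∈ X, ∀ x' ∈ X, ∀ y ∈ Y, ∀ y' ∈ Y, ∀ z ∈ Z, ∀ z' ∈ Z,
      x * y⁻¹ * y' * z⁻¹ = x' * z'⁻¹ → x = x' ∧ y = y' ∧ z = z')
    (f : GLTwo → GLTwo → (GLTwo → ℂ)) (hf : IsSeparatingFamily X Y Z f)
    (hdeg : ∀ x ∈ X, ∀ z ∈ Z, ∃ p : MvPolynomial (Fin 2 × Fin 2) ℂ,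
      p.totalDegree ≤ s ∧ f x z = entryEval p) :
    ((X.card * Y.card * Z.card : ℕ) : ℝ) ^ (omega ℂ / 3) ≤
      (((s + 4).choose 4 : ℕ) : ℝ) * ((s + 1 : ℕ) : ℝ) ^ (omega ℂ - 2) := by
  have hmem : ∀ x ∈ X, ∀ z ∈ Z, f x z ∈ repFun n ρ := fun x hx z hz => by
    obtain ⟨p, hp, hfp⟩ := hdeg x hx z hz
    rw [hfp]
    exact hspan p hp
  have h1 := BCGPU2024_thm_2_2_corrected_holds GLTwo X Y Z hTPP (Fin r) n ρ f hf hmem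
  have h2 := sum_rpow_omega_le_of_le (ι := Fin r) n (d := s + 1) (by omega) hn
    (omega_two_le (K := ℂ))
  have h3 : (∑ i, ((n i : ℕ) : ℝ) ^ 2) ≤ (((s + 4).choose 4 : ℕ) : ℝ) := by
    exact_mod_cast hsum
  have hpow : (0 : ℝ) ≤ ((s + 1 : ℕ) : ℝ) ^ (omega ℂ - 2) := Real.rpow_nonneg (by positivity) _
  exact h1.trans (h2.trans (mul_le_mul_of_nonneg_right h3 hpow))

/-! ## The exponent door -/

/-- Elementary bound on the right-hand side: `C(s+4,4) · (s+1)^{w−2} ≤ (2s)^{w+2}` for `s ≥ 4`,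
`w ≥ 2`. [folklore] -/
theorem choose_mul_rpow_le_two_mul_rpow {s : ℕ} (hs : 4 ≤ s) {w : ℝ} (hw : 2 ≤ w) :
    (((s + 4).choose 4 : ℕ) : ℝ) * ((s + 1 : ℕ) : ℝ) ^ (w - 2) ≤ (2 * (s : ℝ)) ^ (w + 2) := by
  have hs' : (4 : ℝ) ≤ s := by exact_mod_cast hs
  have h2s : (0 : ℝ) < 2 * (s : ℝ) := by linarith
  -- `C(s+4,4) ≤ (s+4)^4 ≤ (2s)^4`
  have hc : (((s + 4).choose 4 : ℕ) : ℝ) ≤ (2 * (s : ℝ)) ^ (4 : ℝ) := by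
    have h1 : (((s + 4).choose 4 : ℕ) : ℝ) ≤ (((s + 4) ^ 4 : ℕ) : ℝ) := by
      exact_mod_cast Nat.choose_le_pow (s + 4) 4
    have h2 : (((s + 4) ^ 4 : ℕ) : ℝ) = ((s : ℝ) + 4) ^ (4 : ℕ) := by push_cast; ring
    have h3 : ((s : ℝ) + 4) ^ (4 : ℕ) ≤ (2 * (s : ℝ)) ^ (4 : ℕ) :=
      pow_le_pow_left₀ (by linarith) (by linarith) 4
    rw [h2] at h1
    calc _ ≤ (2 * (s : ℝ)) ^ (4 : ℕ) := h1.trans h3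
      _ = (2 * (s : ℝ)) ^ (4 : ℝ) := by norm_cast
  -- `(s+1)^{w-2} ≤ (2s)^{w-2}`
  have hp : ((s + 1 : ℕ) : ℝ) ^ (w - 2) ≤ (2 * (s : ℝ)) ^ (w - 2) := by
    refine Real.rpow_le_rpow (by positivity) ?_ (by linarith)
    push_cast
    linarith
  calc (((s + 4).choose 4 : ℕ) : ℝ) * ((s + 1 : ℕ) : ℝ) ^ (w - 2)
      ≤ (2 * (s : ℝ)) ^ (4 : ℝ) * (2 * (s : ℝ)) ^ (w - 2) :=
        mul_le_mul hc hp (Real.rpow_nonneg (by positivity) _) (Real.rpow_nonneg h2s.le _)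
    _ = (2 * (s : ℝ)) ^ (w + 2) := by
        rw [← Real.rpow_add h2s]
        ring_nf

/-- **Exponent door at `GL₂(ℂ)`.** Hypotheses: `hPW` — for every `s`, the truncated Peter–Weyl /
[DRS74] input at degree `s` (a family `ρ_i` with `n_i ≤ s+1`, `∑ n_i² ≤ C(s+4,4)`, `repFun ∋`
every entry polynomial of degree `≤ s`); `hdes` — for some `a > 1` and arbitrarily large `s`, a
TPP triple `X, Y, Z ⊆ GL₂(ℂ)` (embedding form) with a separating family of entry polynomials of
degree `≤ s` and volume `|X||Y||Z| ≥ s^{3a}`. Conclusion: `ω(ℂ) ≤ 2/(a − 1)` (from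
`s^{aω} ≤ C(s+4,4)(s+1)^{ω−2} ≤ (2s)^{ω+2}` for unboundedly many `s`).
[cite: BlasiakCohnGrochowPrattUmans2024, Cor. 2.8 ("In particular"), §4 open problem 4] -/
theorem omega_le_of_glTwo_designs
    (hPW : ∀ s : ℕ, ∃ (r : ℕ) (n : Fin r → ℕ)
      (ρ : ∀ i, GLTwo →* Matrix.GeneralLinearGroup (Fin (n i)) ℂ),
      (∀ i, n i ≤ s + 1) ∧ (∑ i, n i ^ 2 ≤ (s + 4).choose 4) ∧
        ∀ p : MvPolynomial (Fin 2 × Fin 2) ℂ, p.totalDegree ≤ s → entryEval p ∈ repFun n ρ)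
    {a : ℝ} (ha : 1 < a)
    (hdes : ∀ s₀ : ℕ, ∃ s : ℕ, s₀ ≤ s ∧ ∃ X Y Z : Finset GLTwo,
      (∀ x ∈ X, ∀ x' ∈ X, ∀ y ∈ Y, ∀ y' ∈ Y, ∀ z ∈ Z, ∀ z' ∈ Z,
        x * y⁻¹ * y' * z⁻¹ = x' * z'⁻¹ → x = x' ∧ y = y' ∧ z = z') ∧
      (∃ f : GLTwo → GLTwo → (GLTwo → ℂ), IsSeparatingFamily X Y Z f ∧
        ∀ x ∈ X, ∀ z ∈ Z, ∃ p : MvPolynomial (Fin 2 × Fin 2) ℂ,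
          p.totalDegree ≤ s ∧ f x z = entryEval p) ∧
      (s : ℝ) ^ (3 * a) ≤ (X.card : ℝ) * Y.card * Z.card) :
    omega ℂ ≤ 2 / (a - 1) := by
  set w := omega ℂ with hw_def
  have hw2 : 2 ≤ w := omega_two_le (K := ℂ)
  have hω3 : 0 ≤ w / 3 := div_nonneg (zero_le_two.trans hw2) zero_le_three
  by_contra hlt
  rw [not_le] at hlt
  -- `δ := a w − (w + 2) > 0`
  have ha1 : 0 < a - 1 := by linarith
  have hδ : 0 < a * w - (w + 2) := by
    have : 2 < w * (a - 1) := by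
      rw [div_lt_iff₀ ha1] at hlt
      linarith
    nlinarith
  set δ := a * w - (w + 2) with hδ_def
  -- threshold `S = 2^{(w+2)/δ}`; pick a design with `s > max(4, S)`
  set S : ℝ := (2 : ℝ) ^ ((w + 2) / δ) with hS_def
  have hS0 : 0 ≤ S := Real.rpow_nonneg (by norm_num) _
  obtain ⟨s, hs₀, X, Y, Z, hTPP, ⟨f, hf, hdeg⟩, hvol⟩ := hdes (⌈S⌉₊ + 5)
  have hs4 : 4 ≤ s := by omega
  have hsS : S < s := by
    have h1 : S ≤ (⌈S⌉₊ : ℝ) := Nat.le_ceil S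
    have h2 : ((⌈S⌉₊ + 5 : ℕ) : ℝ) ≤ s := by exact_mod_cast hs₀
    push_cast at h2
    linarith
  have hspos : (0 : ℝ) < s := by
    have : (4 : ℝ) ≤ s := by exact_mod_cast hs4
    linarith
  -- the cost inequality at `s`: `(s^{3a})^{w/3} ≤ (|X||Y||Z|)^{w/3} ≤ (2s)^{w+2}`
  obtain ⟨r, n, ρ, hn, hsum, hspan⟩ := hPW s
  have hcast : (X.card : ℝ) * Y.card * Z.card = ((X.card * Y.card * Z.card : ℕ) : ℝ) := by
    push_cast; ring
  have hcost : ((s : ℝ) ^ (3 * a)) ^ (w / 3) ≤ (2 * (s : ℝ)) ^ (w + 2) :=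
    calc ((s : ℝ) ^ (3 * a)) ^ (w / 3) ≤ ((X.card : ℝ) * Y.card * Z.card) ^ (w / 3) :=
          Real.rpow_le_rpow (Real.rpow_nonneg hspos.le _) hvol hω3
      _ = ((X.card * Y.card * Z.card : ℕ) : ℝ) ^ (w / 3) := by rw [hcast]
      _ ≤ (((s + 4).choose 4 : ℕ) : ℝ) * ((s + 1 : ℕ) : ℝ) ^ (w - 2) :=
          glTwo_volume_rpow_le ρ hn hsum hspan hTPP f hf hdeg
      _ ≤ (2 * (s : ℝ)) ^ (w + 2) := choose_mul_rpow_le_two_mul_rpow hs4 hw2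
  have hlhs : ((s : ℝ) ^ (3 * a)) ^ (w / 3) = (s : ℝ) ^ δ * (s : ℝ) ^ (w + 2) := by
    rw [← Real.rpow_mul hspos.le, ← Real.rpow_add hspos]
    congr 1
    rw [hδ_def]
    ring
  have hrhs : (2 * (s : ℝ)) ^ (w + 2) = (2 : ℝ) ^ (w + 2) * (s : ℝ) ^ (w + 2) :=
    Real.mul_rpow (by norm_num) hspos.le
  rw [hlhs, hrhs] at hcost
  have hsw : 0 < (s : ℝ) ^ (w + 2) := Real.rpow_pos_of_pos hspos _
  have hsd : (s : ℝ) ^ δ ≤ (2 : ℝ) ^ (w + 2) := le_of_mul_le_mul_right hcost hsw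
  -- but `s > S = 2^{(w+2)/δ}` forces `s^δ > 2^{w+2}`
  have hgt : (2 : ℝ) ^ (w + 2) < (s : ℝ) ^ δ := by
    have h1 : S ^ δ < (s : ℝ) ^ δ := Real.rpow_lt_rpow hS0 hsS hδ
    have h2 : S ^ δ = (2 : ℝ) ^ (w + 2) := by
      rw [hS_def, ← Real.rpow_mul (by norm_num : (0 : ℝ) ≤ 2)]
      congr 1
      field_simp
    rw [h2] at h1
    exact h1
  exact absurd hsd (not_le.2 hgt)

/-- **The `GL₂` door.** Under the truncated Peter–Weyl input `hPW` (all degrees), degree-`s` TPP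
designs in `GL₂(ℂ)` of volume `s^{3a}` for every `a < 2` (each for arbitrarily large `s`) give
`ω(ℂ) = 2`, i.e. `MatrixMultiplication`. (`a ≤ 2` is forced by the packing count
`|X||Z| ≤ C(s+4,4)`; `ω(ℂ) ≥ 2` is the tree's `omega_two_le`.)
[cite: BlasiakCohnGrochowPrattUmans2024, Cor. 2.8, §4] -/
theorem matrixMultiplication_of_glTwo_designs
    (hPW : ∀ s : ℕ, ∃ (r : ℕ) (n : Fin r → ℕ)
      (ρ : ∀ i, GLTwo →* Matrix.GeneralLinearGroup (Fin (n i)) ℂ),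
      (∀ i, n i ≤ s + 1) ∧ (∑ i, n i ^ 2 ≤ (s + 4).choose 4) ∧
        ∀ p : MvPolynomial (Fin 2 × Fin 2) ℂ, p.totalDegree ≤ s → entryEval p ∈ repFun n ρ)
    (hdes : ∀ a : ℝ, a < 2 → ∀ s₀ : ℕ, ∃ s : ℕ, s₀ ≤ s ∧ ∃ X Y Z : Finset GLTwo,
      (∀ x ∈ X, ∀ x' ∈ X, ∀ y ∈ Y, ∀ y' ∈ Y, ∀ z ∈ Z, ∀ z' ∈ Z,
        x * y⁻¹ * y' * z⁻¹ = x' * z'⁻¹ → x = x' ∧ y = y' ∧ z = z') ∧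
      (∃ f : GLTwo → GLTwo → (GLTwo → ℂ), IsSeparatingFamily X Y Z f ∧
        ∀ x ∈ X, ∀ z ∈ Z, ∃ p : MvPolynomial (Fin 2 × Fin 2) ℂ,
          p.totalDegree ≤ s ∧ f x z = entryEval p) ∧
      (s : ℝ) ^ (3 * a) ≤ (X.card : ℝ) * Y.card * Z.card) :
    _root_.MatrixMultiplication := by
  have hle : omega ℂ ≤ 2 := by
    refine le_of_forall_pos_le_add fun ε hε => ?_
    -- `a = 1 + 2/(2+ε)` has `2/(a-1) = 2 + ε`
    have h2ε : (0 : ℝ) < 2 + ε := by linarith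
    have hq : 0 < 2 / (2 + ε) := div_pos two_pos h2ε
    have hq1 : 2 / (2 + ε) < 1 := by rw [div_lt_one h2ε]; linarith
    have ha1 : (1 : ℝ) < 1 + 2 / (2 + ε) := by linarith
    have ha2 : 1 + 2 / (2 + ε) < 2 := by linarith
    have h := omega_le_of_glTwo_designs hPW ha1 (hdes _ ha2)
    have hval : (2 : ℝ) / (1 + 2 / (2 + ε) - 1) = 2 + ε := by
      field_simp
      ring
    rw [hval] at h
    exact h
  exact _root_.MatrixMultiplication_iff.2 (le_antisymm hle (omega_two_le (K := ℂ)))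

/-- Threshold bookkeeping: for `a > 1` the door's bound `2/(a−1)` is `< 3` iff `a > 5/3`.
[folklore] -/
theorem glTwo_threshold_three {a : ℝ} (ha : 1 < a) : 2 / (a - 1) < 3 ↔ 5 / 3 < a := by
  have ha1 : 0 < a - 1 := by linarith
  rw [div_lt_iff₀ ha1]
  constructor <;> intro h <;> linarith

/-- At the trivial level `a = 4/3` (volume `s⁴`, e.g. `Y = {1}` and `|X||Z| = C(s+4,4)`) the door
reads `ω ≤ 6`. [folklore] -/
theorem glTwo_trivial_level : (2 : ℝ) / (4 / 3 - 1) = 6 := by norm_num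

end Summit.MatrixMultiplication.MatrixMultiplication.Theorems

end
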